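import Summits.NavierStokesRegularity.FunctionalMining.StretchingLaminateProfiles
import Summits.NavierStokesRegularity.FunctionalMining.StretchingConfinementErrors
import Summits.NavierStokesRegularity.FunctionalMining.StretchingFillerPotential
import HarnessLib

/-!
# K1-Q1 laminate step, part 4: the LAMINATE POTENTIAL `A = A_lam + E₊•(A₊)_m + E₋•(A₋)_m` and its gradient

Cell `pub-nsfunc` (host summit NavierStokesRegularity, topic `FunctionalMining`), prove seat gen 6, for the
`LaminateStep` node (dict BLUEPRINT §1(d)). **Search for candidate a priori estimates; no regularity claim.**
Static smooth fields on `T³`; nothing about Navier–Stokes.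

`LamData` bundles the construction data: laminate parameters `q = (λ, ε)`, an integer direction `k ≠ 0`, an
amplitude `c ∈ ℝ³` with `c·k = 0`, a normal scale `a` (the rational normal is `n = a k`, so `c ⊗ n = M` with
`M i j = cᵢ·a·kⱼ`), and the two smooth child potentials `A₊, A₋`. Then
* `lamVel x = (a·Φ(k·x))•c` is smooth and divergence free with `∇ lamVel (x) = φ(k·x)·M` (`gradAt_lamVel`);
* `Apot = Confinement.potential lamVel` has `∇ curl Apot = ∇ lamVel` (`gradAt_curlField_Apot`);
* `Atot m = Apot + confine E₊ (rescale A₊ m) + confine E₋ (rescale A₋ m)` is smooth and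
  `∇ curl (Atot m)(x) = φ(k·x)·M + ∇curl(E₊•(A₊)_m)(x) + ∇curl(E₋•(A₋)_m)(x)` (`gradAt_curlField_Atot`),
  each child term being `E±(x)·∇curl A±(m•x)` up to the tree's remainder `ρ_m = (2L₂a₀ + 4L₁a₁)/m`
  (`Confinement.abs_gradAt_curl_confine_sub_le`).
-/

noncomputable section

open MeasureTheory Set Filter Topology Function
open scoped ContDiff

namespace Summit.NavierStokesRegularity.FunctionalMining

open Literature.Analysis Literature.Analysis.FunctionSpaces Literature.Analysis.FunctionSpaces.Torus
open Literature.Analysis.FluidPDE Literature.Analysis.FluidPDE.Torus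
open LaminateWindow LaminateDirection WrapStretching Confinement

/-! ## 1. Linearity bookkeeping for `curlField` and `gradAt` -/

/-- `gradAt (u + v) = gradAt u + gradAt v` for `C¹` fields. [folklore] -/
theorem WrapStretching.gradAt_add {u v : UnitAddTorus (Fin 3) → EuclideanSpace ℝ (Fin 3)} (hu : IsSmooth u) (hv : IsSmooth v)
    (x : UnitAddTorus (Fin 3)) : gradAt (u + v) x = gradAt u x + gradAt v x := by
  funext i j
  simp only [gradAt, Pi.add_apply]
  rw [partialDeriv_add (hu.isContDiff (by simp)) (hv.isContDiff (by simp))]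
  rfl

/-- `curl (A + B) = curl A + curl B` for smooth potentials. [folklore] -/
theorem WrapStretching.curlField_add {A B : UnitAddTorus (Fin 3) → EuclideanSpace ℝ (Fin 3)} (hA : IsSmooth A) (hB : IsSmooth B) :
    curlField (A + B) = curlField A + curlField B := by
  funext x
  have h : ∀ j, Torus.partialDeriv j (A + B) x = Torus.partialDeriv j A x + Torus.partialDeriv j B x := fun j => by
    rw [partialDeriv_add (hA.isContDiff (by simp)) (hB.isContDiff (by simp))]; rfl
  ext i
  simp only [Pi.add_apply, PiLp.add_apply, curlField_apply, h]
  ring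

/-- `∇ curl (A + B) = ∇ curl A + ∇ curl B`. [folklore] -/
theorem WrapStretching.gradAt_curlField_add {A B : UnitAddTorus (Fin 3) → EuclideanSpace ℝ (Fin 3)} (hA : IsSmooth A)
    (hB : IsSmooth B) (x : UnitAddTorus (Fin 3)) :
    gradAt (curlField (A + B)) x = gradAt (curlField A) x + gradAt (curlField B) x := by
  rw [curlField_add hA hB, gradAt_add (isSmooth_curlField hA) (isSmooth_curlField hB)]

/-! ## 2. The construction data -/

/-- **Construction data of one laminate step.** [ours; bookkeeping] -/
structure LamData where
  /-- laminate parameters `(λ, ε)` -/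
  q : LamParam
  /-- integer layering direction -/
  k : Fin 3 → ℤ
  /-- the direction is nonzero -/
  hk : k ≠ 0
  /-- amplitude vector -/
  c : EuclideanSpace ℝ (Fin 3)
  /-- normal scale: the normal is `n = a • k` -/
  a : ℝ
  /-- divergence-free rank-one direction: `c · k = 0` -/
  hck : ∑ j, c j * (k j : ℝ) = 0
  /-- potential of the `+` child -/
  Ap : UnitAddTorus (Fin 3) → EuclideanSpace ℝ (Fin 3)
  /-- potential of the `−` child -/
  Am : UnitAddTorus (Fin 3) → EuclideanSpace ℝ (Fin 3)
  /-- smoothness of `A₊` -/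
  hAp : IsSmooth Ap
  /-- smoothness of `A₋` -/
  hAm : IsSmooth Am

namespace LamData

variable (D : LamData)

/-- The rank-one matrix `M = c ⊗ n`, `M i j = cᵢ · (a kⱼ)`. [ours; bookkeeping] -/
def M (i j : Fin 3) : ℝ := D.c i * (D.a * (D.k j : ℝ))

/-- The laminate slope at `x`: `φ(k·x)`. [ours; bookkeeping] -/
def slope (x : UnitAddTorus (Fin 3)) : ℝ := dirFun D.k D.q.phi x

/-- The envelopes `E₊ = e₊(k·x)`, `E₋ = e₋(k·x)`. [ours; bookkeeping] -/
def EP (x : UnitAddTorus (Fin 3)) : ℝ := D.q.envP D.k x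

/-- The envelope `E₋ = e₋(k·x)`. [ours; bookkeeping] -/
def EM (x : UnitAddTorus (Fin 3)) : ℝ := D.q.envM D.k x

/-- The child gradients `X± = ∇ curl A±`. [ours; bookkeeping] -/
def XP (y : UnitAddTorus (Fin 3)) : Fin 3 → Fin 3 → ℝ := gradAt (curlField D.Ap) y

/-- The child gradient `X₋ = ∇ curl A₋`. [ours; bookkeeping] -/
def XM (y : UnitAddTorus (Fin 3)) : Fin 3 → Fin 3 → ℝ := gradAt (curlField D.Am) y

/-! ## 3. The laminate velocity and its potential -/

/-- The scalar laminate amplitude `a · Φ(k·x)`. [ours; bookkeeping] -/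
def lamScal (x : UnitAddTorus (Fin 3)) : ℝ := D.a * dirFun D.k D.q.Phi x

/-- **The laminate velocity** `w(x) = (a Φ(k·x)) • c`. [ours] -/
def lamVel (x : UnitAddTorus (Fin 3)) : EuclideanSpace ℝ (Fin 3) := D.lamScal x • D.c

/-- The amplitude is smooth. [folklore] -/
theorem isSmooth_lamScal : IsSmooth D.lamScal := (isSmooth_dirFun D.k D.q.Phi).smul D.a

/-- `∂ⱼ(aΦ(k·x)) = a kⱼ φ(k·x)`. [folklore] -/
theorem partialDeriv_lamScal (j : Fin 3) (x : UnitAddTorus (Fin 3)) :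
    Torus.partialDeriv j D.lamScal x = D.a * (D.k j : ℝ) * D.slope x := by
  rw [show D.lamScal = D.a • dirFun D.k D.q.Phi from rfl, partialDeriv_const_smul (isContDiff_dirFun D.k D.q.Phi),
    Pi.smul_apply, smul_eq_mul, partialDeriv_dirFun, slope, dirFun, dirFun, D.q.Phi_D_onCircle]
  ring

/-- The laminate velocity is smooth. [folklore] -/
theorem isSmooth_lamVel : IsSmooth D.lamVel := D.isSmooth_lamScal.smul' (isSmooth_const _)

/-- **`∇w(x) = φ(k·x) · M`.** [ours] -/
theorem gradAt_lamVel (x : UnitAddTorus (Fin 3)) (i j : Fin 3) : gradAt D.lamVel x i j = D.slope x * D.M i j := by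
  simp only [gradAt]
  rw [show D.lamVel = fun y => D.lamScal y • D.c from rfl,
    partialDeriv_smul' (D.isSmooth_lamScal.isContDiff (by simp)) ((isSmooth_const _).isContDiff (by simp)),
    show Torus.partialDeriv j (fun _ : UnitAddTorus (Fin 3) => D.c) x = 0 by
      unfold Torus.partialDeriv Torus.lineDeriv; simp,
    smul_zero, add_zero, PiLp.smul_apply, smul_eq_mul, partialDeriv_lamScal, M]
  ring

/-- **`w` is divergence free** (`c · k = 0`). [ours] -/
theorem isDivFree_lamVel : IsDivFree D.lamVel := by
  intro x
  unfold Torus.divergence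
  have h : ∀ i, Torus.partialDeriv i (fun y => D.lamVel y i) x = D.slope x * D.M i i := fun i => by
    rw [partialDeriv_apply_coord (D.isSmooth_lamVel.isContDiff (by simp))]; exact D.gradAt_lamVel x i i
  simp_rw [h, M]
  rw [← Finset.mul_sum]
  have : ∑ i : Fin 3, D.c i * (D.a * (D.k i : ℝ)) = D.a * ∑ i, D.c i * (D.k i : ℝ) := by
    rw [Finset.mul_sum]; exact Finset.sum_congr rfl fun i _ => by ring
  rw [this, D.hck, mul_zero, mul_zero]

/-- **The laminate potential** `A_lam = potential w`. [ours] -/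
def Apot : UnitAddTorus (Fin 3) → EuclideanSpace ℝ (Fin 3) := potential D.lamVel

/-- `A_lam` is smooth. [folklore] -/
theorem isSmooth_Apot : IsSmooth D.Apot := isSmooth_potential D.isSmooth_lamVel

/-- **`∇ curl A_lam = ∇w = φ(k·x)·M`.** [ours] -/
theorem gradAt_curlField_Apot (x : UnitAddTorus (Fin 3)) (i j : Fin 3) :
    gradAt (curlField D.Apot) x i j = D.slope x * D.M i j := by
  have hc : curlField D.Apot = fun y => D.lamVel y - ∫ z, D.lamVel z :=
    funext fun y => curlField_potential D.isSmooth_lamVel D.isDivFree_lamVel y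
  rw [hc, gradAt_sub_const _ D.isSmooth_lamVel, gradAt_lamVel]

/-! ## 4. The confined children and the total potential -/

/-- The confined `+` child `E₊ • (A₊)_m`. [ours; bookkeeping] -/
def BP (m : ℕ) : UnitAddTorus (Fin 3) → EuclideanSpace ℝ (Fin 3) := confine D.EP (rescale D.Ap m)

/-- The confined `−` child `E₋ • (A₋)_m`. [ours; bookkeeping] -/
def BM (m : ℕ) : UnitAddTorus (Fin 3) → EuclideanSpace ℝ (Fin 3) := confine D.EM (rescale D.Am m)

/-- `E₊` is smooth. [folklore] -/
theorem isSmooth_EP : IsSmooth D.EP := D.q.isSmooth_envP D.k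

/-- `E₋` is smooth. [folklore] -/
theorem isSmooth_EM : IsSmooth D.EM := D.q.isSmooth_envM D.k

/-- The confined children are smooth. [folklore] -/
theorem isSmooth_BP (m : ℕ) : IsSmooth (D.BP m) := isSmooth_confine D.isSmooth_EP (isSmooth_rescale m D.hAp)

/-- The confined children are smooth. [folklore] -/
theorem isSmooth_BM (m : ℕ) : IsSmooth (D.BM m) := isSmooth_confine D.isSmooth_EM (isSmooth_rescale m D.hAm)

/-- **The total potential** `A = A_lam + E₊•(A₊)_m + E₋•(A₋)_m`. [ours] -/
def Atot (m : ℕ) : UnitAddTorus (Fin 3) → EuclideanSpace ℝ (Fin 3) := D.Apot + D.BP m + D.BM m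

/-- `A` is smooth. [folklore] -/
theorem isSmooth_Atot (m : ℕ) : IsSmooth (D.Atot m) := (D.isSmooth_Apot.add (D.isSmooth_BP m)).add (D.isSmooth_BM m)

/-- **Gradient of `curl A`**: laminate part + the two confined children. [ours] -/
theorem gradAt_curlField_Atot (m : ℕ) (x : UnitAddTorus (Fin 3)) (i j : Fin 3) :
    gradAt (curlField (D.Atot m)) x i j =
      D.slope x * D.M i j + gradAt (curlField (D.BP m)) x i j + gradAt (curlField (D.BM m)) x i j := by
  rw [Atot, gradAt_curlField_add (D.isSmooth_Apot.add (D.isSmooth_BP m)) (D.isSmooth_BM m),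
    gradAt_curlField_add D.isSmooth_Apot (D.isSmooth_BP m)]
  simp only [Pi.add_apply]
  rw [gradAt_curlField_Apot]

/-! ## 5. Pointwise facts: envelope values, nesting, slope range -/

/-- `0 ≤ E₊ ≤ 1`. [ours; bookkeeping] -/
theorem EP_mem (x : UnitAddTorus (Fin 3)) : 0 ≤ D.EP x ∧ D.EP x ≤ 1 := D.q.envP_mem D.k x

/-- `0 ≤ E₋ ≤ 1`. [ours; bookkeeping] -/
theorem EM_mem (x : UnitAddTorus (Fin 3)) : 0 ≤ D.EM x ∧ D.EM x ≤ 1 := D.q.envM_mem D.k x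

/-- On `supp E₊`: slope `= 1 − μ` and `E₋ = 0`. [ours] -/
theorem EP_ne_zero {x : UnitAddTorus (Fin 3)} (h : D.EP x ≠ 0) : D.slope x = 1 - D.q.mu ∧ D.EM x = 0 :=
  D.q.envP_ne_zero D.k h

/-- On `supp E₋`: slope `= −μ` and `E₊ = 0`. [ours] -/
theorem EM_ne_zero {x : UnitAddTorus (Fin 3)} (h : D.EM x ≠ 0) : D.slope x = -D.q.mu ∧ D.EP x = 0 :=
  D.q.envM_ne_zero D.k h

/-- The slope lies in `[−μ, 1 − μ]`. [ours; bookkeeping] -/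
theorem slope_mem (x : UnitAddTorus (Fin 3)) : -D.q.mu ≤ D.slope x ∧ D.slope x ≤ 1 - D.q.mu :=
  ⟨(D.q.dirFun_phi_mem D.k x).1, (D.q.dirFun_phi_mem D.k x).2⟩

/-- `|slope| ≤ 1`. [ours; bookkeeping] -/
theorem abs_slope_le (x : UnitAddTorus (Fin 3)) : |D.slope x| ≤ 1 := abs_dirFun_le D.k D.q.abs_phi_le x

/-- The slope is smooth (hence continuous). [folklore] -/
theorem continuous_slope : Continuous D.slope := continuous_dirFun D.k D.q.phi

/-! ## 6. Period integrals of the envelopes -/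

/-- `∫ E₊^p = ∫₀¹ e₊^p`. [ours; bookkeeping] -/
theorem integral_EP_pow (p : ℕ) : ∫ x, D.EP x ^ p = ∫ t in (0 : ℝ)..1, D.q.ePlus t ^ p :=
  integral_dirFun_pow D.hk D.q.ePlus p

/-- `∫ E₋^p = ∫₀¹ e₋^p`. [ours; bookkeeping] -/
theorem integral_EM_pow (p : ℕ) : ∫ x, D.EM x ^ p = ∫ t in (0 : ℝ)..1, D.q.eMinus t ^ p :=
  integral_dirFun_pow D.hk D.q.eMinus p

/-- **`|∫ E₊^p − λ| ≤ 4ε`** (`p ≥ 1`). [ours] -/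
theorem abs_integral_EP_pow_sub_le {p : ℕ} (hp : 1 ≤ p) : |(∫ x, D.EP x ^ p) - D.q.lam| ≤ 4 * D.q.eps := by
  rw [integral_EP_pow]
  have h := D.q.integral_ePlus_pow_bounds hp
  rw [abs_le]; constructor <;> linarith [h.1, h.2, D.q.heps]

/-- **`|∫ E₋^p − (1 − λ)| ≤ 4ε`** (`p ≥ 1`). [ours] -/
theorem abs_integral_EM_pow_sub_le {p : ℕ} (hp : 1 ≤ p) : |(∫ x, D.EM x ^ p) - (1 - D.q.lam)| ≤ 4 * D.q.eps := by
  rw [integral_EM_pow]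
  have h := D.q.integral_eMinus_pow_bounds hp
  rw [abs_le]; constructor <;> linarith [h.1, h.2, D.q.heps]

/-- **Laminate statistics of a bounded observable**: `|∫ Q(slope(x) + μ) dx − (λQ(1) + (1−λ)Q(0))| ≤ 4ε·K`
(`Q` continuous, `|Q| ≤ K` on `[0,1]`; the slope plus `μ` is the window `b(k·x)`). [ours] -/
theorem abs_integral_comp_slope_sub_le {Q : ℝ → ℝ} (hQ : Continuous Q) {K : ℝ} (hK : ∀ s ∈ Icc (0 : ℝ) 1, |Q s| ≤ K) :
    |(∫ x, Q (D.slope x + D.q.mu)) - (D.q.lam * Q 1 + (1 - D.q.lam) * Q 0)| ≤ 4 * D.q.eps * K := by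
  have h1 : ∫ x, Q (D.slope x + D.q.mu) = ∫ t in (0 : ℝ)..1, Q (D.q.bProf t) := by
    have := integral_dirFun_comp D.hk D.q.phi (Q := fun s => Q (s + D.q.mu)) (hQ.comp (continuous_id.add continuous_const))
    simp only [slope]
    rw [this]
    simp only [LamParam.phi_apply, sub_add_cancel]
  rw [h1]
  exact D.q.abs_integral_comp_bProf_sub_le hQ hK

end LamData

end Summit.NavierStokesRegularity.FunctionalMining

end
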